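import Literature.AnabelianGeometry.EtaleTheta.LogDivisorModelTateTowerKummerTwistGroup

/-!
# [EtTh] Def. 3.3 (i)(c)/(ii) v2: the COMPATIBLE part `Ẑ(1)² ⋊ Ẑˣ × ℤ_γ` of the ζ-twisted Kummer–Tate group, and its levels

S. Mochizuki, *The étale theta function …*, Publ. RIMS **45** (2009) [MochizukiEtTh2009], §1 p.13 (the constant field acts on
`N`-th roots through the cyclotomic character, compatibly in `N`), §3 Def. 3.3 (i)(c) p.72, (ii) p.73
[cite: MochizukiEtTh2009, Def 3.3 (ii) p.73].

CLASS (b) DESIGN MODEL, sequel (b′) of `LogDivisorModelTateTowerKummerTwistGroup.lean` (abc-iut cell, layer L2, row R677/R689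
«ζ-TWISTED KUMMER ACTION ON THE TATE TOWER»; seat abc-iut-L1-t6 g4).  The group `TateTowerKummerTwist.Grp =
(∏_n (ℤ/M_n)² ⋊_χ ∏_n (ℤ/M_n)ˣ) × ℤ_γ` of that file carries NO compatibility between levels; the tower laws of Def. 3.3
(iii) (piece (d): equivariance `resFn_act` of the pull-backs `Z_∞^{(j)} → Z_∞^{(i)}`) hold exactly on the CLOSED SUBGROUP of
compatible families — `k_j ≡ k_i`, `χ_j(c) ≡ χ_i(c) (mod M_i)` for `i ≤ j` — i.e. on `Ẑ(1)² ⋊ Ẑˣ × ℤ_γ` with `Ẑˣ` acting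
through THE cyclotomic character.  This file supplies it:
* `res h : ℤ/M_j → ℤ/M_i` (`ZMod.castHom`, `i ≤ j`), `resK`, `resC` and `resK_smul` (the twist is compatible with restriction);
* **`compat : Subgroup Grp`** (closed under the twisted multiplication because `χ` acts by ring multiplication), `isClosed_compat`;
* `Compat := ↥compat` (subspace topology; a topological group), the level subgroups `closureC n := Δ_n ∩ compat` — NORMAL,
  nested, PAIRWISE DISTINCT (`natElt j` = the integer `(j+1)!` on the diagonal `ℤ ⊂ Ẑ`, `natElt_mem_closureC_iff`,
  `le_of_closureC_le`), every open neighbourhood of `1` containing one of them (`exists_closureC_subset_of_isOpen`);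
* **`levelsC : LevelSystem Compat`, both laws PROVED** (conjugate stabilisers + normality, as in the parent file).
HONEST LABEL: a combinatorial design model for the v2 interface, NOT the tempered fundamental group of a Tate curve; no new
instance (the subtype instances are Mathlib's); nothing here bears on [IUTchIII] Cor. 3.12; no side taken; typed ≠ proved.
-/

noncomputable section

namespace Literature.AnabelianGeometry.EtaleTheta

open CategoryTheory Function Literature.AlgebraicGeometry.Frobenioids
  Literature.AlgebraicGeometry.Frobenioids.QuasiTemperoid Literature.AnabelianGeometry.SemiGraphs

namespace TateTowerKummerTwist

/-! ## Restriction between levels -/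

/-- `M_i ∣ M_j` for `i ≤ j`. [cite: MochizukiEtTh2009, Def 3.3 (ii) p.73] -/
theorem M_dvd {i j : ℕ} (h : i ≤ j) : M i ∣ M j := Nat.factorial_dvd_factorial (by omega)

/-- The restriction `ℤ/M_j → ℤ/M_i` (`i ≤ j`). [cite: MochizukiEtTh2009, Def 3.3 (ii) p.73] -/
abbrev res {i j : ℕ} (h : i ≤ j) : ZMod (M j) →+* ZMod (M i) := ZMod.castHom (M_dvd h) (ZMod (M i))

/-- Restriction on the two Kummer coordinates of one level. [cite: MochizukiEtTh2009, Def 3.3 (ii) p.73] -/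
abbrev resK {i j : ℕ} (h : i ≤ j) : ZMod (M j) × ZMod (M j) →+ ZMod (M i) × ZMod (M i) :=
  (res h).toAddMonoidHom.prodMap (res h).toAddMonoidHom

/-- Restriction on the constant-field coordinate of one level. [cite: MochizukiEtTh2009, §1 p.13] -/
abbrev resC {i j : ℕ} (h : i ≤ j) : (ZMod (M j))ˣ →* (ZMod (M i))ˣ := Units.map (res h).toMonoidHom

/-- The twist commutes with restriction: `res (χ_j(c) · k) = χ_i(c) · res k` when `χ_i(c) = res χ_j(c)`.
[cite: MochizukiEtTh2009, §1 p.13] -/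
theorem resK_smul {i j : ℕ} (h : i ≤ j) (u : (ZMod (M j))ˣ) (p : ZMod (M j) × ZMod (M j)) :
    resK h (u • p) = resC h u • resK h p := by
  refine Prod.ext ?_ ?_
  · change res h ((u : ZMod (M j)) * p.1) = (res h (u : ZMod (M j))) * res h p.1
    rw [map_mul]
  · change res h ((u : ZMod (M j)) * p.2) = (res h (u : ZMod (M j))) * res h p.2
    rw [map_mul]

/-! ## The compatible subgroup -/

/-- Coordinates of a product: `(g h)_j = k^g_j + χ_j(c^g) · k^h_j`. [cite: MochizukiEtTh2009, §1 p.13] -/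
theorem toAdd_left_mul (g h : Grp) (j : ℕ) :
    (g * h).1.left.toAdd j = g.1.left.toAdd j + g.1.right j • h.1.left.toAdd j := rfl

/-- Coordinates of an inverse: `(g⁻¹)_j = χ_j(c^g)⁻¹ · (−k^g_j)`. [cite: MochizukiEtTh2009, §1 p.13] -/
theorem toAdd_left_inv (g : Grp) (j : ℕ) : (g⁻¹).1.left.toAdd j = (g.1.right j)⁻¹ • (-(g.1.left.toAdd j)) := rfl

/-- **The compatible subgroup `Ẑ(1)² ⋊ Ẑˣ × ℤ_γ ≤ Grp`**: families of Kummer coordinates and of values of the cyclotomic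
character compatible under restriction between levels (a subgroup: restriction is additive and multiplicative, and the
twist is compatible with it, `resK_smul`). [cite: MochizukiEtTh2009, §1 p.13] -/
def compat : Subgroup Grp where
  carrier := {g | (∀ i j (h : i ≤ j), resK h (g.1.left.toAdd j) = g.1.left.toAdd i) ∧
    ∀ i j (h : i ≤ j), resC h (g.1.right j) = g.1.right i}
  one_mem' := ⟨fun i j h => by rw [Prod.fst_one, SemidirectProduct.one_left, toAdd_one, Pi.zero_apply, Pi.zero_apply,
      map_zero], fun i j h => by rw [Prod.fst_one, SemidirectProduct.one_right, Pi.one_apply, Pi.one_apply, map_one]⟩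
  mul_mem' := by
    rintro a b ⟨ha, ha'⟩ ⟨hb, hb'⟩
    refine ⟨fun i j h => ?_, fun i j h => ?_⟩
    · rw [toAdd_left_mul, toAdd_left_mul, map_add, resK_smul, ha i j h, hb i j h, ha' i j h]
    · rw [Prod.fst_mul, SemidirectProduct.mul_right, Pi.mul_apply, Pi.mul_apply, map_mul, ha' i j h, hb' i j h]
  inv_mem' := by
    rintro a ⟨ha, ha'⟩
    refine ⟨fun i j h => ?_, fun i j h => ?_⟩
    · rw [toAdd_left_inv, toAdd_left_inv, resK_smul, map_neg, map_inv, ha i j h, ha' i j h]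
    · rw [Prod.fst_inv, SemidirectProduct.inv_right, Pi.inv_apply, Pi.inv_apply, map_inv, ha' i j h]

/-- Membership in `compat`. [cite: MochizukiEtTh2009, §1 p.13] -/
theorem mem_compat_iff (g : Grp) : g ∈ compat ↔
    (∀ i j (h : i ≤ j), resK h (g.1.left.toAdd j) = g.1.left.toAdd i) ∧
      ∀ i j (h : i ≤ j), resC h (g.1.right j) = g.1.right i := Iff.rfl

/-- The Kummer coordinates of level `j` depend continuously on `g ∈ Grp`. [cite: MochizukiEtTh2009, Def 3.3 (ii) p.73] -/
theorem continuous_coordK (j : ℕ) : Continuous fun g : Grp => g.1.left.toAdd j :=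
  (continuous_apply j).comp (continuous_toAdd.comp
    ((SettingModel.Semidirect.continuous_left isInducing_leftRight).comp continuous_fst))

/-- The constant-field coordinate of level `j` depends continuously on `g ∈ Grp`. [cite: MochizukiEtTh2009, §1 p.13] -/
theorem continuous_coordC (j : ℕ) : Continuous fun g : Grp => g.1.right j :=
  (continuous_apply j).comp ((SettingModel.Semidirect.continuous_right isInducing_leftRight).comp continuous_fst)

/-- **`compat` is closed** (an intersection of equalisers of continuous maps into discrete spaces).
[cite: MochizukiEtTh2009, §1 p.13] -/
theorem isClosed_compat : IsClosed (compat : Set Grp) := by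
  change IsClosed {g : Grp | (∀ i j (h : i ≤ j), resK h (g.1.left.toAdd j) = g.1.left.toAdd i) ∧
    ∀ i j (h : i ≤ j), resC h (g.1.right j) = g.1.right i}
  simp only [Set.setOf_and, Set.setOf_forall]
  refine IsClosed.inter (isClosed_iInter fun i => isClosed_iInter fun j => isClosed_iInter fun h => isClosed_eq ?_ ?_)
    (isClosed_iInter fun i => isClosed_iInter fun j => isClosed_iInter fun h => isClosed_eq ?_ ?_)
  · exact continuous_of_discreteTopology.comp (continuous_coordK j)
  · exact continuous_coordK i
  · exact continuous_of_discreteTopology.comp (continuous_coordC j)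
  · exact continuous_coordC i

/-- The compatible group `Ẑ(1)² ⋊ Ẑˣ × ℤ_γ` as a topological group (subspace topology).
[cite: MochizukiEtTh2009, §1 p.13] -/
abbrev Compat : Type := ↥compat

/-! ## Level subgroups of the compatible group -/

/-- `Δ_n ∩ compat`, the level-`n` subgroup of the compatible group. [cite: MochizukiEtTh2009, Def 3.3 (i) p.72] -/
def closureC (n : ℕ) : Subgroup Compat := (closure n).subgroupOf compat

/-- Membership in `closureC n`. [cite: MochizukiEtTh2009, Def 3.3 (i) p.72] -/
theorem mem_closureC_iff (n : ℕ) (g : Compat) : g ∈ closureC n ↔ (g : Grp) ∈ closure n := Subgroup.mem_subgroupOf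

/-- `closureC n` is normal. [cite: MochizukiEtTh2009, Def 3.3 (i) p.72] -/
theorem closureC_normal (n : ℕ) : (closureC n).Normal := by
  refine ⟨fun g hg h => ?_⟩
  rw [mem_closureC_iff] at hg ⊢
  rw [Subgroup.coe_mul, Subgroup.coe_mul, Subgroup.coe_inv]
  exact (closure_normal n).conj_mem _ hg _

/-- The `closureC n` are nested. [cite: MochizukiEtTh2009, Def 3.3 (i) p.72] -/
theorem closureC_antitone {n m : ℕ} (h : n ≤ m) : closureC m ≤ closureC n :=
  fun g hg => (mem_closureC_iff n g).2 (closure_antitone h ((mem_closureC_iff m g).1 hg))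

/-- **Every open neighbourhood of `1` in the compatible group contains some `closureC n`** (trace of the parent statement).
[cite: MochizukiEtTh2009, Def 3.3 (i) p.72] -/
theorem exists_closureC_subset_of_isOpen {U : Set Compat} (hU : IsOpen U) (h1 : (1 : Compat) ∈ U) :
    ∃ n, (closureC n : Set Compat) ⊆ U := by
  obtain ⟨V, hV, hVU⟩ := isOpen_induced_iff.1 hU
  have h1V : (1 : Grp) ∈ V := by
    have : (1 : Compat) ∈ Subtype.val ⁻¹' V := by rw [hVU]; exact h1
    exact this
  obtain ⟨n, hn⟩ := exists_closure_subset_of_isOpen hV h1V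
  refine ⟨n, fun g hg => ?_⟩
  rw [← hVU]
  exact hn ((mem_closureC_iff n g).1 hg)

/-- The diagonal element of the compatible group attached to the integer `(j+1)!` on the first Kummer coordinate
(an element of `ℤ ⊂ Ẑ(1)`; compatible because restriction fixes integers). [cite: MochizukiEtTh2009, Def 3.3 (ii) p.73] -/
def natElt (j : ℕ) : Compat :=
  ⟨ofKum (Multiplicative.ofAdd fun n => ((((j + 1).factorial : ℕ) : ZMod (M n)), 0)), by
    refine ⟨fun i i' h => ?_, fun i i' h => ?_⟩
    · rw [ofKum, SemidirectProduct.left_inl, toAdd_ofAdd]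
      exact Prod.ext (map_natCast (res h) _) (map_zero (res h))
    · rw [ofKum, SemidirectProduct.right_inl, Pi.one_apply, Pi.one_apply, map_one]⟩

/-- `(j+1)!` vanishes in `ℤ/M_i = ℤ/(i+2)!` exactly for `i < j`. [cite: MochizukiEtTh2009, Def 3.3 (ii) p.73] -/
theorem natCast_factorial_eq_zero_iff (i j : ℕ) : ((((j + 1).factorial : ℕ) : ZMod (M i)) = 0) ↔ i < j := by
  rw [ZMod.natCast_eq_zero_iff]
  constructor
  · intro h
    by_contra hij
    have hle : (i + 2).factorial ≤ (j + 1).factorial := Nat.le_of_dvd (Nat.factorial_pos _) h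
    have hlt : (j + 1).factorial < (i + 2).factorial := (Nat.factorial_lt (Nat.succ_pos j)).2 (by omega)
    omega
  · intro h
    exact Nat.factorial_dvd_factorial (by omega)

/-- `natElt j ∈ closureC m ↔ m ≤ j`. [cite: MochizukiEtTh2009, Def 3.3 (i) p.72] -/
theorem natElt_mem_closureC_iff (j m : ℕ) : natElt j ∈ closureC m ↔ m ≤ j := by
  rw [mem_closureC_iff, natElt, ofKum_mem_closure_iff]
  simp only [toAdd_ofAdd, Prod.mk_eq_zero, and_true, natCast_factorial_eq_zero_iff]
  constructor
  · intro h
    by_contra hm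
    exact lt_irrefl j (h j (lt_of_not_ge hm))
  · intro h i hi
    exact lt_of_lt_of_le hi h

/-- `closureC j ≤ closureC i` forces `i ≤ j`: the levels stay pairwise distinct inside the compatible group.
[cite: MochizukiEtTh2009, Def 3.3 (i) p.72] -/
theorem le_of_closureC_le {i j : ℕ} (h : closureC j ≤ closureC i) : i ≤ j :=
  (natElt_mem_closureC_iff j i).1 (h ((natElt_mem_closureC_iff j j).2 le_rfl))

/-! ## The level of a connected tempered `Compat`-set -/

/-- A point of a tempered `Compat`-set is fixed by some `closureC n`. [cite: MochizukiEtTh2009, Def 3.3 (ii) p.73] -/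
theorem exists_closureC_fix (T : BTemp Compat) (y : T.obj.V) : ∃ n, ∀ g ∈ closureC n, T.obj.ρ g y = y := by
  obtain ⟨n, hn⟩ := exists_closureC_subset_of_isOpen (T.property.2 y) (BTempConnected.ρ_one_apply T y)
  exact ⟨n, fun g hg => hn hg⟩

/-- For a CONNECTED tempered `Compat`-set one `closureC n` fixes every point (one orbit, conjugate stabilisers, normality).
[cite: MochizukiEtTh2009, Def 3.3 (ii) p.73] -/
theorem exists_closureC_fixes (Y : ConnectedPart (BTemp Compat)) :
    ∃ n, ∀ g ∈ closureC n, ∀ y : Y.obj.obj.V, Y.obj.obj.ρ g y = y := by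
  obtain ⟨y₀⟩ := BTempConnected.nonempty_of_isConnectedObj Y.obj Y.property
  obtain ⟨n, hn⟩ := exists_closureC_fix Y.obj y₀
  refine ⟨n, fun g hg y => ?_⟩
  obtain ⟨h, rfl⟩ := BTempConnected.exists_ρ_eq_of_isConnectedObj Y.obj Y.property y₀ y
  have hc : h⁻¹ * g * h⁻¹⁻¹ ∈ closureC n := (closureC_normal n).conj_mem g hg h⁻¹
  rw [inv_inv] at hc
  rw [← BTempConnected.ρ_mul_apply, show g * h = h * (h⁻¹ * g * h) by
      rw [← mul_assoc, ← mul_assoc, mul_inv_cancel, one_mul],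
    BTempConnected.ρ_mul_apply, hn _ hc]

/-- The level of a connected tempered `Compat`-set: the least `n` with `closureC n` acting trivially.
[cite: MochizukiEtTh2009, Def 3.3 (ii) p.73] -/
def lvlC (Y : ConnectedPart (BTemp Compat)) : ℕ := sInf {n | ∀ g ∈ closureC n, ∀ y : Y.obj.obj.V, Y.obj.obj.ρ g y = y}

/-- `closureC (lvlC Y)` fixes `Y`. [cite: MochizukiEtTh2009, Def 3.3 (i) p.72] -/
theorem closureC_lvlC_fixes (Y : ConnectedPart (BTemp Compat)) :
    ∀ g ∈ closureC (lvlC Y), ∀ y : Y.obj.obj.V, Y.obj.obj.ρ g y = y :=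
  Nat.sInf_mem (s := {n | ∀ g ∈ closureC n, ∀ y : Y.obj.obj.V, Y.obj.obj.ρ g y = y}) (exists_closureC_fixes Y)

/-- Minimality of the level. [cite: MochizukiEtTh2009, Def 3.3 (i) p.72] -/
theorem lvlC_le {Y : ConnectedPart (BTemp Compat)} {n : ℕ}
    (h : ∀ g ∈ closureC n, ∀ y : Y.obj.obj.V, Y.obj.obj.ρ g y = y) : lvlC Y ≤ n :=
  Nat.sInf_le h

/-- Levels are monotone along covering maps. [cite: MochizukiEtTh2009, Def 3.3 (i) p.72] -/
theorem lvlC_le_of_hom {Y Y' : ConnectedPart (BTemp Compat)} (f : Y' ⟶ Y) : lvlC Y ≤ lvlC Y' := by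
  obtain ⟨y'₀⟩ := BTempConnected.nonempty_of_isConnectedObj Y'.obj Y'.property
  refine lvlC_le fun g hg y => ?_
  obtain ⟨y', rfl⟩ := BTempConnected.surjective_of_isConnectedObj y'₀ Y.property f.hom y
  rw [← BTempConnected.hom_ρ, closureC_lvlC_fixes Y' g hg y']

/-- **The level structure of the compatible ζ-twisted Kummer–Tate group** `Ẑ(1)² ⋊ Ẑˣ × ℤ_γ` (Def. 3.3 (i)(c)/(ii)): levels
`ℕ`, normal `closureC n`, `lvlC`; BOTH laws PROVED — the `LevelSystem` over which the tower of piece (d) is equivariant.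
[cite: MochizukiEtTh2009, Def 3.3 (i) p.72] -/
def levelsC : LevelSystem Compat where
  I := ℕ
  closure := closureC
  closure_normal := closureC_normal
  lvl := lvlC
  closure_lvl_act Y g hg y := closureC_lvlC_fixes Y g hg y
  closure_lvl_mono f := closureC_antitone (lvlC_le_of_hom f)

/-- The levels of `levelsC` are linearly ordered by their closures. [cite: MochizukiEtTh2009, Def 3.3 (ii) p.73] -/
theorem levelsC_le_of_closure_le {i j : ℕ} (h : levelsC.closure j ≤ levelsC.closure i) : i ≤ j := le_of_closureC_le h

end TateTowerKummerTwist

end Literature.AnabelianGeometry.EtaleTheta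

end
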